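import Literature.NumberTheory.EllipticCurves.Kolyvagin1989TheoremB
import Literature.NumberTheory.EllipticCurves.Rank1Residual.Typed.X5DescentAnyLevel
import Summits.BirchSwinnertonDyer.Rank1Residual.X5.TwoAdicTargets
import HarnessLib

/-!
# X5 at `p = 2`: THE HEEGNER-INDEX DOOR — which certified data discharge `X5.MissingInputAt W 2`
# for a curve of analytic rank `0` with `E(ℚ)[2] = 0`, `#Ш[2] = 4` (unit `b2b-bsdres-sha-1`, GEN 41)

HONEST FRAMING: prove what is provable now; shrink each hard class to its core with data; no claim beyond
stated classes. Everything in this file is PROVED; the named facts entering the consumers are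
Gross–Zagier–Kolyvagin (`hGZK`, bsd.S17) and Kolyvagin 1989 Theorem B₂ (`hB2`,
`Literature.NumberTheory.EllipticCurves.Kolyvagin1989_theoremB_two`, used as a hypothesis). Nothing is
claimed for any curve: every certificate line is a displayed hypothesis; nothing is booked; no class
word, mark, count or tier moves. Prepared by the planner seat `planner-b2b-bsdres-sha-1-g41-0` (no stage
permission under `Summits/`); to be filed by a prover-role seat of the cell.

THE DOOR (HOME `b2b-bsdres-sha-1/X5-ROUTE.md`, bullets GEN 32–41; census `koly2/icheck/gen41/TALLY.md`):
on the 61 X5-core classes with `t = dim E(ℚ)[2] = 0`, odd Tamagawa numbers and `r_an = 0`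
(`#Ш(E/ℚ)_an = 4^K`, `K ∈ {2, 3, 4}`), Kolyvagin's Theorem B₂ for a Heegner field `K_D` with (H1)
`ρ_{E,2^∞}(G_ℚ) = GL₂(ℤ₂)` and (H2) `K_D ∉ {ℚ(i), ℚ(√-2), ℚ(√-|Δ|), ℚ(√-2|Δ|)}` gives
`C_D · Ш(E/ℚ)[2^∞] = 0`; a per-pair certificate `ord₂ [E(K_D) : ℤ y_D] = K` (the cell's MODE L records,
R-tier, re-verified I-tier) then gives the EXPONENT `2^K · Ш(E/ℚ)[2^∞] = 0`, i.e. the missing UPPER line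
`Ш[2^(K+1)] = Ш[2^K]` of the X5 descent datum; the LOWER lines (`#Ш[2] = 4` from the `2`-descent, the
lifting record `Ш[2^(K-1)] ⊆ 2Ш` from the `2^K`-descent) are the level records already in the tree's
currency (`X5/LevelRecords*.lean`, `Typed/X5DescentAnyLevel.lean`). This file proves the composition:

* §1 `two_pow_smul_eq_zero_of_smul_eq_zero` — `I • x = 0`, `2^(k+1) ∤ I`, `x` `2`-power torsion ⟹ `2^k • x = 0`;
* §2 `sha_two_pow_smul_eq_zero_of_kolyvaginB_two` — B₂ + (H1) + (H2) + `2^(k+1) ∤ [E(K):ℤP]` ⟹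
  `2^k · Ш(E/ℚ)[2^∞] = 0`;
* §3 `descentCertificateAt_of_exponent_of_lift`, `missingInputAt_two_of_exponent_of_lift`,
  `bsdp_two_of_exponent_of_lift` — exponent `2^(k+1)` + `#Ш[2] = 4` + `Ш[2^k] ⊆ 2Ш` + `ord₂ #Ш_an = 2(k+1)`
  ⟹ `X5.DescentCertificateAt W` ⟹ `X5.MissingInputAt W 2` ⟹ (GZK) `BSD(E, 2)`;
* §4 `bsdp_two_of_selmer_lift_of_exponent` — the same over the tree's Selmer groups (`#E(ℚ)[2] = 2^t`,
  `#Sel^(2) = 2^(r_an+t+2)`, every `2^k`-Selmer class lifts to `Sel^(2^(k+1))`);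
* §5 `bsdp_two_of_kolyvaginB_two`, `missingInputAt_two_of_kolyvaginB_two` — THE DOOR THEOREM at class
  level `K = k + 1`: PRINT {`hGZK`, `hB2`} · PER-PAIR DATA {Heegner field and point, `r_an(E) = 0`, (H1) as
  `O1.TwoAdicSurjective W` (kernel-decidable by `O1.twoAdicSurjective_of_certificates`), (H2)} ·
  CERTIFICATES {`2^(K+1) ∤ [E(K):ℤP]`, `#E(ℚ)[2] = 2^t`, `#Sel^(2)(E/ℚ) = 2^(t+2)`, the level-`K` lifting
  record, `ord₂ #Ш(E/ℚ)_an = 2K`} ⟹ `BSD(E, 2)`;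
* §6 `descentCertificateAt_of_kolyvaginB_two`, `bsdp_two_of_isIsogenous_of_kolyvaginB_two` — CLASS LEVEL:
  the door datum read on one member `W'` gives `BSD(W, 2)` for every `ℚ`-isogenous `W` (Cassels'
  isogeny invariance `hCassels`, modularity `hmod`; `Typed.X5.bsdp_two_of_isIsogenous_of_descentCertificateAt`);
* §7 `card_torsionBy_two_pow_succ_le`, `card_torsionBy_two_pow_le_pow` (`#A[2^(k+1)] ≤ #A[2]·#A[2^k]`,
  `#A[2^k] ≤ (#A[2])^k`), `missingUpperBoundAt_two_of_exponent`, `missingUpperBoundAt_two_of_kolyvaginB_two` —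
  the UPPER HALF ALONE (`ord₂ #Ш ≤ 2K ≤ ord₂ #Ш_an`, `MissingUpperBoundAt W 2`) from the door + `#Ш[2] = 4`,
  with NO lifting record: what the door delivers on a class whose level-`K` lifting line is not certified
  (the three `K = 4` doors 300060b1, 349522b1, 380052m1 have engine-G records at level `2` only).

WHAT THIS IS NOT: not a proof of Theorem B₂ (a named Literature fact, hypothesis `hB2`); not a discharge
of any certificate; the (H1)-✗ classes of the census (185761b1, 302642a1, 344450bg1: `2`-adic image of
index `2`) are OUTSIDE this door.

References: [Kolyvagin1989Izv] Thm. B_l (l = 2) p. 475–476, Prop. 16; [Miller2011LMS] §1, Def. 1.1;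
[SilvermanAEC2009] Thm. X.4.2(a); [Cassels1998] §1; [MerrimanSiksekSmart1996] §4; [GrossZagier1986] I.(6.5), V.(2.2).
-/

noncomputable section

open scoped Classical

namespace Summit.BirchSwinnertonDyer.Rank1Residual.X5.HeegnerIndexDoor

open WeierstrassCurve Literature.NumberTheory.EllipticCurves
  Literature.NumberTheory.EllipticCurves.Rank1Residual
  Literature.NumberTheory.EllipticCurves.Rank1Residual.Typed

universe u

/-! ### §1 Algebra: an annihilator not divisible by `2^(k+1)` kills `2`-power torsion at level `k` -/

/-- If `I • x = 0` with `2^(k+1) ∤ I` and `x` is `2`-power torsion, then `2^k • x = 0`: the order of `x` is a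
power `2^j` dividing `I`, so `j ≤ k`. [folklore] -/
theorem two_pow_smul_eq_zero_of_smul_eq_zero {A : Type*} [AddCommGroup A] {I k n : ℕ}
    (hI : ¬ 2 ^ (k + 1) ∣ I) {x : A} (hn : 2 ^ n • x = 0) (hIx : I • x = 0) : 2 ^ k • x = 0 := by
  have h1 : addOrderOf x ∣ 2 ^ n := addOrderOf_dvd_iff_nsmul_eq_zero.2 hn
  obtain ⟨j, -, hj⟩ := (Nat.dvd_prime_pow Nat.prime_two).1 h1
  have h2 : addOrderOf x ∣ I := addOrderOf_dvd_iff_nsmul_eq_zero.2 hIx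
  rw [hj] at h2
  have hjk : j ≤ k := by
    by_contra h
    exact hI ((pow_dvd_pow 2 (by omega)).trans h2)
  apply addOrderOf_dvd_iff_nsmul_eq_zero.1
  rw [hj]
  exact pow_dvd_pow 2 hjk

/-! ### §2 The door: Kolyvagin's Theorem B₂ + a Heegner-index certificate ⟹ an exponent for `Ш(E/ℚ)[2^∞]` -/

section Door

variable {N : ℕ} [NeZero N] (W : WeierstrassCurve ℚ) {K : Type u} [Field K] [NumberField K]

/-- **THE HEEGNER-INDEX DOOR at `p = 2` (exponent form).** Granted Kolyvagin's Theorem B₂ (`hB2`, a named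
Literature fact used as a hypothesis), for `E/ℚ` of analytic rank `0` with `ρ_{E,2^∞}` onto `GL₂(ℤ₂)` (H1),
a Heegner field `K = ℚ(√D)` (`D ≠ -3, -4, -8`, `D·(-|Δ|)`, `D·(-2|Δ|)` non-squares: (H2)) and a non-torsion
Heegner point `P ∈ E(K)` whose index `[E(K) : ℤP]` is NOT divisible by `2^(k+1)` (the per-pair
CERTIFICATE), every element of `Ш(E/ℚ)[2^∞]` is killed by `2^k`. Nothing is claimed for any curve: `hI` is
the certified input. [cite: Kolyvagin1989Izv, Thm. B_l (l = 2), p. 475–476] -/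
theorem sha_two_pow_smul_eq_zero_of_kolyvaginB_two (hB2 : Kolyvagin1989_theoremB_two N W K)
    [W.IsElliptic] (hK : IsImaginaryQuadratic K) (hH : SatisfiesHeegnerHypothesis N K)
    (h3 : NumberField.discr K ≠ -3) (h4 : NumberField.discr K ≠ -4)
    {P : (W.baseChange K).toAffine.Point} (hP : IsHeegnerPoint N W K P) (hnt : ¬ IsOfFinAddOrder P)
    (hr0 : W.analyticRank = 0) (hρ : O1.TwoAdicSurjective W) (h8 : NumberField.discr K ≠ -8)
    (hΔ₁ : ¬ IsSquare ((NumberField.discr K : ℚ) * -|W.Δ|))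
    (hΔ₂ : ¬ IsSquare ((NumberField.discr K : ℚ) * (-(2 * |W.Δ|))))
    {k : ℕ} (hI : ¬ 2 ^ (k + 1) ∣ (AddSubgroup.zmultiples P).index) :
    ∀ (x : W.sha) (n : ℕ), 2 ^ n • x = 0 → 2 ^ k • x = 0 := fun x n hn =>
  two_pow_smul_eq_zero_of_smul_eq_zero hI hn ((hB2 hK hH h3 h4 hP hnt hr0 hρ h8 hΔ₁ hΔ₂).2 x n hn)

end Door

/-! ### §3 Exponent + lifting line + analytic valuation ⟹ the X5 descent datum (Ш-currency) -/

section ShaCurrency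

variable (W : WeierstrassCurve ℚ)

/-- **The door closes the datum at class level `K = k + 1` (Ш-currency):** `#Ш[2] = 4`, the lifting
line `Ш[2^k] ⊆ 2Ш` (so `#Ш[2^(k+1)] = 4^(k+1)`, `card_torsionBy_two_pow_of_two_divisible`), the EXPONENT
`2^(k+1) · Ш[2^∞] = 0` (so `Ш[2^(k+2)] = Ш[2^(k+1)]`) and `ord₂ #Ш_an = 2(k+1)` give
`X5.DescentCertificateAt W` at level `k + 1`. [cite: Miller2011LMS, Def. 1.1] [cite: MerrimanSiksekSmart1996, §4] -/
theorem descentCertificateAt_of_exponent_of_lift {k : ℕ}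
    (h2 : Nat.card (AddSubgroup.torsionBy W.sha 2) = 4)
    (hdiv : ∀ y : W.sha, 2 ^ k • y = 0 → ∃ x : W.sha, 2 • x = y)
    (hexp : ∀ (x : W.sha) (n : ℕ), 2 ^ n • x = 0 → 2 ^ (k + 1) • x = 0)
    {q : ℚ} (hq : shaAn W = (q : ℂ)) (hv : padicValRat 2 q = ((2 * (k + 1) : ℕ) : ℤ)) :
    X5.DescentCertificateAt W := by
  refine X5.descentCertificateAt_of_level W (k := k + 1) (m := 2 * (k + 1))
    (fun x hx => hexp x (k + 1 + 1) hx) ?_ hq hv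
  rw [card_torsionBy_two_pow_of_two_divisible h2 hdiv, pow_mul]
  norm_num

/-- **… hence discharges the typed missing input `X5.MissingInputAt W 2`** (`Ш` finite).
[cite: Miller2011LMS, §1 and Def. 1.1] -/
theorem missingInputAt_two_of_exponent_of_lift (hfin : W.ShaFinite) {k : ℕ}
    (h2 : Nat.card (AddSubgroup.torsionBy W.sha 2) = 4)
    (hdiv : ∀ y : W.sha, 2 ^ k • y = 0 → ∃ x : W.sha, 2 • x = y)
    (hexp : ∀ (x : W.sha) (n : ℕ), 2 ^ n • x = 0 → 2 ^ (k + 1) • x = 0)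
    {q : ℚ} (hq : shaAn W = (q : ℂ)) (hv : padicValRat 2 q = ((2 * (k + 1) : ℕ) : ℤ)) :
    Typed.X5.MissingInputAt W 2 :=
  X5.missingInputAt_of_descentCertificateAt W hfin
    (descentCertificateAt_of_exponent_of_lift W h2 hdiv hexp hq hv)

variable [W.IsElliptic] [W.IsGloballyMinimal]

/-- **… and gives `BSD(E, 2)` in analytic rank `≤ 1`** (GZK `hGZK` for finiteness and `rank = r_an`).
[cite: Miller2011LMS, §1 and Def. 1.1] -/
theorem bsdp_two_of_exponent_of_lift (hGZK : rank_eq_analyticRank_of_analyticRank_le_one)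
    (hr : W.analyticRank ≤ 1) {k : ℕ}
    (h2 : Nat.card (AddSubgroup.torsionBy W.sha 2) = 4)
    (hdiv : ∀ y : W.sha, 2 ^ k • y = 0 → ∃ x : W.sha, 2 • x = y)
    (hexp : ∀ (x : W.sha) (n : ℕ), 2 ^ n • x = 0 → 2 ^ (k + 1) • x = 0)
    {q : ℚ} (hq : shaAn W = (q : ℂ)) (hv : padicValRat 2 q = ((2 * (k + 1) : ℕ) : ℤ)) : BSDp W 2 :=
  X5.bsdp_two_of_descentCertificateAt W hGZK hr
    (descentCertificateAt_of_exponent_of_lift W h2 hdiv hexp hq hv)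

/-! ### §4 Selmer currency: `#E(ℚ)[2]`, `#Sel^(2)`, the lifting record `Sel^(2^k) → Sel^(2^(k+1))` -/

/-- **The door closes `BSD(E, 2)` from the tree's Selmer groups:** analytic rank `≤ 1`,
`#E(ℚ)[2] = 2^t`, `#Sel^(2)(E/ℚ) = 2^(r_an + t + 2)` (`#Ш[2] = 4`), every `2^k`-Selmer class lifts to
`Sel^(2^(k+1))` (`Ш[2^k] ⊆ 2Ш`), the EXPONENT `2^(k+1)·Ш[2^∞] = 0`, and `ord₂ #Ш_an = 2(k+1)`. Compared
with `X5.bsdp_two_of_selmer_item_level` the non-lifting `2^(k+1)`-Selmer class (a `2^(k+2)`-descent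
verdict) is REPLACED by the exponent. [cite: SilvermanAEC2009, Thm. X.4.2(a); Cassels1998, §1; Miller2011LMS, Def. 1.1] -/
theorem bsdp_two_of_selmer_lift_of_exponent (hGZK : rank_eq_analyticRank_of_analyticRank_le_one)
    (hr : W.analyticRank ≤ 1) {t : ℕ}
    (ht : Nat.card (AddSubgroup.torsionBy W.toAffine.Point 2) = 2 ^ t)
    (hSel : Nat.card (W.selmerGroup 2) = 2 ^ (W.analyticRank + t + 2)) {k : ℕ}
    (hF : ∀ s : W.selmerGroup (2 ^ k : ℕ), ∃ z : W.selmerGroup (2 ^ (k + 1) : ℕ),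
      W.selmerZSMul 2 (two_pow_succ_dvd_mul_two k) z = s)
    (hexp : ∀ (x : W.sha) (n : ℕ), 2 ^ n • x = 0 → 2 ^ (k + 1) • x = 0)
    {q : ℚ} (hq : shaAn W = (q : ℂ)) (hv : padicValRat 2 q = ((2 * (k + 1) : ℕ) : ℤ)) : BSDp W 2 :=
  bsdp_two_of_exponent_of_lift W hGZK hr
    (X5.card_sha_two_of_card_selmerTwo W (hGZK W hr).1 ht hSel)
    (X5.two_divisible_of_selmer_lift_level W hF) hexp hq hv

/-! ### §5 THE DOOR THEOREM: which certified data at `p = 2` discharge `X5.MissingInputAt` for a rank-0 curve -/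

variable {N : ℕ} [NeZero N] {K : Type u} [Field K] [NumberField K]

/-- **`BSD(E, 2)` THROUGH THE HEEGNER-INDEX DOOR (class level `K = k + 1`).** PRINT: Gross–Zagier–Kolyvagin
`hGZK` (bsd.S17) and Kolyvagin 1989 Theorem B₂ `hB2`. PER-PAIR DATA `(E, D)`: the Heegner field
`K = ℚ(√D)` (`hK`, `hH`, `D ≠ -3, -4, -8`, the two non-square conditions (H2)), a non-torsion Heegner point
`P ∈ E(K)` (`hP`, `hnt`), `r_an(E) = 0` (`hr0`), `ρ_{E,2^∞}(G_ℚ) = GL₂(ℤ₂)` (`hρ`, (H1), kernel-decidable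
by `O1.twoAdicSurjective_of_certificates`). CERTIFICATES: the Heegner INDEX `[E(K) : ℤP]` is not divisible
by `2^(k+2)` (`hI`; i.e. `ord₂ [E(K):ℤ y_K] ≤ k + 1 = K`), `#E(ℚ)[2] = 2^t` and `#Sel^(2)(E/ℚ) = 2^(t+2)`
(`2`-descent), every `2^k`-Selmer class lifts to `Sel^(2^(k+1))` (`2^K`-descent lifting record), and
`ord₂ #Ш(E/ℚ)_an = 2(k+1) = 2K` (exact analytic valuation). CONCLUSION: Miller's `BSD(E, 2)`. Nothing is
claimed for any curve; every certificate is a displayed hypothesis. [cite: Kolyvagin1989Izv, Thm. B_l (l = 2), p. 475–476]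
[cite: Miller2011LMS, §1 and Def. 1.1] [cite: SilvermanAEC2009, Thm. X.4.2(a)] -/
theorem bsdp_two_of_kolyvaginB_two (hGZK : rank_eq_analyticRank_of_analyticRank_le_one)
    (hB2 : Kolyvagin1989_theoremB_two N W K)
    (hK : IsImaginaryQuadratic K) (hH : SatisfiesHeegnerHypothesis N K)
    (h3 : NumberField.discr K ≠ -3) (h4 : NumberField.discr K ≠ -4) (h8 : NumberField.discr K ≠ -8)
    (hΔ₁ : ¬ IsSquare ((NumberField.discr K : ℚ) * -|W.Δ|))
    (hΔ₂ : ¬ IsSquare ((NumberField.discr K : ℚ) * (-(2 * |W.Δ|))))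
    {P : (W.baseChange K).toAffine.Point} (hP : IsHeegnerPoint N W K P) (hnt : ¬ IsOfFinAddOrder P)
    (hr0 : W.analyticRank = 0) (hρ : O1.TwoAdicSurjective W)
    {k : ℕ} (hI : ¬ 2 ^ (k + 2) ∣ (AddSubgroup.zmultiples P).index)
    {t : ℕ} (ht : Nat.card (AddSubgroup.torsionBy W.toAffine.Point 2) = 2 ^ t)
    (hSel : Nat.card (W.selmerGroup 2) = 2 ^ (t + 2))
    (hF : ∀ s : W.selmerGroup (2 ^ k : ℕ), ∃ z : W.selmerGroup (2 ^ (k + 1) : ℕ),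
      W.selmerZSMul 2 (two_pow_succ_dvd_mul_two k) z = s)
    {q : ℚ} (hq : shaAn W = (q : ℂ)) (hv : padicValRat 2 q = ((2 * (k + 1) : ℕ) : ℤ)) : BSDp W 2 :=
  have hr : W.analyticRank ≤ 1 := by omega
  bsdp_two_of_selmer_lift_of_exponent W hGZK hr ht (by rw [hr0, Nat.zero_add]; exact hSel) hF
    (sha_two_pow_smul_eq_zero_of_kolyvaginB_two W hB2 hK hH h3 h4 hP hnt hr0 hρ h8 hΔ₁ hΔ₂ hI) hq hv

omit [W.IsElliptic] [W.IsGloballyMinimal] in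
/-- **The same data discharge the typed missing input `X5.MissingInputAt W 2` itself** (Ш-currency,
`Ш` finite — at `r_an ≤ 1` by GZK). [cite: Kolyvagin1989Izv, Thm. B_l (l = 2), p. 475–476] [cite: Miller2011LMS, Def. 1.1] -/
theorem missingInputAt_two_of_kolyvaginB_two [W.IsElliptic] (hfin : W.ShaFinite)
    (hB2 : Kolyvagin1989_theoremB_two N W K)
    (hK : IsImaginaryQuadratic K) (hH : SatisfiesHeegnerHypothesis N K)
    (h3 : NumberField.discr K ≠ -3) (h4 : NumberField.discr K ≠ -4) (h8 : NumberField.discr K ≠ -8)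
    (hΔ₁ : ¬ IsSquare ((NumberField.discr K : ℚ) * -|W.Δ|))
    (hΔ₂ : ¬ IsSquare ((NumberField.discr K : ℚ) * (-(2 * |W.Δ|))))
    {P : (W.baseChange K).toAffine.Point} (hP : IsHeegnerPoint N W K P) (hnt : ¬ IsOfFinAddOrder P)
    (hr0 : W.analyticRank = 0) (hρ : O1.TwoAdicSurjective W)
    {k : ℕ} (hI : ¬ 2 ^ (k + 2) ∣ (AddSubgroup.zmultiples P).index)
    (h2 : Nat.card (AddSubgroup.torsionBy W.sha 2) = 4)
    (hdiv : ∀ y : W.sha, 2 ^ k • y = 0 → ∃ x : W.sha, 2 • x = y)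
    {q : ℚ} (hq : shaAn W = (q : ℂ)) (hv : padicValRat 2 q = ((2 * (k + 1) : ℕ) : ℤ)) :
    Typed.X5.MissingInputAt W 2 :=
  missingInputAt_two_of_exponent_of_lift W hfin h2 hdiv
    (sha_two_pow_smul_eq_zero_of_kolyvaginB_two W hB2 hK hH h3 h4 hP hnt hr0 hρ h8 hΔ₁ hΔ₂ hI) hq hv

/-! ### §6 Class level: the door datum on one member transports along `ℚ`-isogenies -/

omit [W.IsElliptic] [W.IsGloballyMinimal] in
/-- **The door yields the X5 descent datum itself** (Selmer currency, `rank E(ℚ) = 0`): the input of the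
isogeny transport below. [cite: Kolyvagin1989Izv, Thm. B_l (l = 2), p. 475–476] [cite: Miller2011LMS, Def. 1.1] -/
theorem descentCertificateAt_of_kolyvaginB_two [W.IsElliptic] (hrank : W.mordellWeilRank = 0)
    (hB2 : Kolyvagin1989_theoremB_two N W K)
    (hK : IsImaginaryQuadratic K) (hH : SatisfiesHeegnerHypothesis N K)
    (h3 : NumberField.discr K ≠ -3) (h4 : NumberField.discr K ≠ -4) (h8 : NumberField.discr K ≠ -8)
    (hΔ₁ : ¬ IsSquare ((NumberField.discr K : ℚ) * -|W.Δ|))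
    (hΔ₂ : ¬ IsSquare ((NumberField.discr K : ℚ) * (-(2 * |W.Δ|))))
    {P : (W.baseChange K).toAffine.Point} (hP : IsHeegnerPoint N W K P) (hnt : ¬ IsOfFinAddOrder P)
    (hr0 : W.analyticRank = 0) (hρ : O1.TwoAdicSurjective W)
    {k : ℕ} (hI : ¬ 2 ^ (k + 2) ∣ (AddSubgroup.zmultiples P).index)
    {t : ℕ} (ht : Nat.card (AddSubgroup.torsionBy W.toAffine.Point 2) = 2 ^ t)
    (hSel : Nat.card (W.selmerGroup 2) = 2 ^ (t + 2))
    (hF : ∀ s : W.selmerGroup (2 ^ k : ℕ), ∃ z : W.selmerGroup (2 ^ (k + 1) : ℕ),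
      W.selmerZSMul 2 (two_pow_succ_dvd_mul_two k) z = s)
    {q : ℚ} (hq : shaAn W = (q : ℂ)) (hv : padicValRat 2 q = ((2 * (k + 1) : ℕ) : ℤ)) :
    X5.DescentCertificateAt W :=
  descentCertificateAt_of_exponent_of_lift W
    (X5.card_sha_two_of_card_selmerTwo W hrank ht (by rw [Nat.zero_add]; exact hSel))
    (X5.two_divisible_of_selmer_lift_level W hF)
    (sha_two_pow_smul_eq_zero_of_kolyvaginB_two W hB2 hK hH h3 h4 hP hnt hr0 hρ h8 hΔ₁ hΔ₂ hI) hq hv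

/-- **CLASS LEVEL: `BSD(W, 2)` for every curve `W` `ℚ`-isogenous to a member `W'` that passes the door**
(Cassels' isogeny invariance `hCassels`, modularity `hmod`, GZK `hGZK`; on the X5 core `E[2]` is
irreducible, so every isogeny in the class has odd degree, but the transport needs no parity). All door
data are read on `W'`. [cite: MilneADT2006, Thm. I.7.3] [cite: Kolyvagin1989Izv, Thm. B_l (l = 2), p. 475–476] [cite: Miller2011LMS, §1] -/
theorem bsdp_two_of_isIsogenous_of_kolyvaginB_two (hGZK : rank_eq_analyticRank_of_analyticRank_le_one)
    (hCassels : bsdRHS_eq_of_isIsogenous) (hmod : hasEntireLFunction_rat)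
    {W' : WeierstrassCurve ℚ} [W'.IsElliptic] [W'.IsGloballyMinimal] (hiso : IsIsogenous W W')
    (hB2 : Kolyvagin1989_theoremB_two N W' K)
    (hK : IsImaginaryQuadratic K) (hH : SatisfiesHeegnerHypothesis N K)
    (h3 : NumberField.discr K ≠ -3) (h4 : NumberField.discr K ≠ -4) (h8 : NumberField.discr K ≠ -8)
    (hΔ₁ : ¬ IsSquare ((NumberField.discr K : ℚ) * -|W'.Δ|))
    (hΔ₂ : ¬ IsSquare ((NumberField.discr K : ℚ) * (-(2 * |W'.Δ|))))
    {P : (W'.baseChange K).toAffine.Point} (hP : IsHeegnerPoint N W' K P) (hnt : ¬ IsOfFinAddOrder P)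
    (hr0 : W'.analyticRank = 0) (hρ : O1.TwoAdicSurjective W')
    {k : ℕ} (hI : ¬ 2 ^ (k + 2) ∣ (AddSubgroup.zmultiples P).index)
    {t : ℕ} (ht : Nat.card (AddSubgroup.torsionBy W'.toAffine.Point 2) = 2 ^ t)
    (hSel : Nat.card (W'.selmerGroup 2) = 2 ^ (t + 2))
    (hF : ∀ s : W'.selmerGroup (2 ^ k : ℕ), ∃ z : W'.selmerGroup (2 ^ (k + 1) : ℕ),
      W'.selmerZSMul 2 (two_pow_succ_dvd_mul_two k) z = s)
    {q : ℚ} (hq : shaAn W' = (q : ℂ)) (hv : padicValRat 2 q = ((2 * (k + 1) : ℕ) : ℤ)) : BSDp W 2 :=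
  have hr' : W'.analyticRank ≤ 1 := by omega
  X5.bsdp_two_of_isIsogenous_of_descentCertificateAt W hGZK hCassels hmod hiso hr'
    (descentCertificateAt_of_kolyvaginB_two W' ((hGZK W' hr').1.trans hr0) hB2 hK hH h3 h4 h8 hΔ₁ hΔ₂
      hP hnt hr0 hρ hI ht hSel hF hq hv)

end ShaCurrency

/-! ### §7 The UPPER half alone from the exponent (no lifting line): `ord₂ #Ш ≤ 2K ≤ ord₂ #Ш_an` -/

section Upper

/-- **`#A[2^(k+1)] ≤ #A[2] · #A[2^k]`** for a finite abelian group: doubling maps `A[2^(k+1)]` INTO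
`A[2^k]` with kernel `A[2]` (the inequality form of `card_torsionBy_two_pow_succ_of_two_divisible`).
[cite: SilvermanAEC2009, Thm X.4.2(a) (the descent count; the group theory is elementary)] -/
theorem card_torsionBy_two_pow_succ_le {A : Type*} [AddCommGroup A] [Finite A] (k : ℕ) :
    Nat.card (AddSubgroup.torsionBy A (2 ^ (k + 1) : ℕ)) ≤
      Nat.card (AddSubgroup.torsionBy A 2) * Nat.card (AddSubgroup.torsionBy A (2 ^ k : ℕ)) := by
  let f : AddSubgroup.torsionBy A (2 ^ (k + 1) : ℕ) →+ A :=
    (nsmulAddMonoidHom 2).comp (AddSubgroup.torsionBy A (2 ^ (k + 1) : ℕ)).subtype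
  have hf : ∀ x : AddSubgroup.torsionBy A (2 ^ (k + 1) : ℕ), f x = 2 • (x : A) := fun x => rfl
  have hmemS : ∀ x : A, x ∈ AddSubgroup.torsionBy A (2 ^ (k + 1) : ℕ) ↔ 2 ^ (k + 1) • x = 0 :=
    fun x => AddSubgroup.torsionBy.nsmul_iff (n := 2 ^ (k + 1))
  have hmemk : ∀ x : A, x ∈ AddSubgroup.torsionBy A (2 ^ k : ℕ) ↔ 2 ^ k • x = 0 :=
    fun x => AddSubgroup.torsionBy.nsmul_iff (n := 2 ^ k)
  have hmem2 : ∀ x : A, x ∈ AddSubgroup.torsionBy A 2 ↔ 2 • x = 0 :=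
    fun x => AddSubgroup.torsionBy.nsmul_iff (n := 2)
  -- the range lies in `A[2^k]`
  have hrange : f.range ≤ AddSubgroup.torsionBy A (2 ^ k : ℕ) := by
    rintro y ⟨x, rfl⟩
    rw [hmemk, hf, smul_smul, ← pow_succ]
    exact (hmemS x).1 x.2
  -- the kernel is `A[2]` seen inside `A[2^(k+1)]`
  have hle : AddSubgroup.torsionBy A 2 ≤ AddSubgroup.torsionBy A (2 ^ (k + 1) : ℕ) := by
    intro x hx
    rw [hmem2] at hx
    rw [hmemS, pow_succ, ← smul_smul, hx, smul_zero]
  have hker : f.ker = (AddSubgroup.torsionBy A 2).addSubgroupOf (AddSubgroup.torsionBy A (2 ^ (k + 1) : ℕ)) := by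
    ext x
    rw [AddMonoidHom.mem_ker, AddSubgroup.mem_addSubgroupOf, hmem2, hf]
  have hcker : Nat.card f.ker = Nat.card (AddSubgroup.torsionBy A 2) := by
    rw [hker, Nat.card_congr (AddSubgroup.addSubgroupOfEquivOfLe hle).toEquiv]
  have hcrange : Nat.card f.range ≤ Nat.card (AddSubgroup.torsionBy A (2 ^ k : ℕ)) :=
    AddSubgroup.card_le_of_le hrange
  have hmul := f.ker.card_mul_index
  rw [AddSubgroup.index_ker, hcker] at hmul
  calc Nat.card (AddSubgroup.torsionBy A (2 ^ (k + 1) : ℕ))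
      = Nat.card (AddSubgroup.torsionBy A 2) * Nat.card f.range := hmul.symm
    _ ≤ Nat.card (AddSubgroup.torsionBy A 2) * Nat.card (AddSubgroup.torsionBy A (2 ^ k : ℕ)) :=
      Nat.mul_le_mul_left _ hcrange

/-- **`#A[2^k] ≤ (#A[2])^k`** for a finite abelian group (induction on the level). [folklore] -/
theorem card_torsionBy_two_pow_le_pow {A : Type*} [AddCommGroup A] [Finite A] (k : ℕ) :
    Nat.card (AddSubgroup.torsionBy A (2 ^ k : ℕ)) ≤ Nat.card (AddSubgroup.torsionBy A 2) ^ k := by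
  induction k with
  | zero =>
    have hbot : AddSubgroup.torsionBy A (2 ^ 0 : ℕ) = ⊥ := by
      ext x
      rw [AddSubgroup.torsionBy.nsmul_iff, AddSubgroup.mem_bot, pow_zero, one_smul]
    rw [hbot, AddSubgroup.card_bot, pow_zero]
  | succ k ih =>
    calc Nat.card (AddSubgroup.torsionBy A (2 ^ (k + 1) : ℕ))
        ≤ Nat.card (AddSubgroup.torsionBy A 2) * Nat.card (AddSubgroup.torsionBy A (2 ^ k : ℕ)) :=
          card_torsionBy_two_pow_succ_le k
      _ ≤ Nat.card (AddSubgroup.torsionBy A 2) * Nat.card (AddSubgroup.torsionBy A 2) ^ k :=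
          Nat.mul_le_mul_left _ ih
      _ = Nat.card (AddSubgroup.torsionBy A 2) ^ (k + 1) := (pow_succ' _ _).symm

variable (W : WeierstrassCurve ℚ)

/-- **The UPPER half from the exponent alone** (`Ш` finite): `#Ш[2] = 4` and `2^K · Ш[2^∞] = 0` give
`Ш[2^∞] = Ш[2^K]` of order `≤ 4^K`, so `ord₂ #Ш(E/ℚ) ≤ 2K`; with `2K ≤ ord₂ #Ш_an` this is
`MissingUpperBoundAt W 2` — WITHOUT any lifting record (what the door delivers on a class whose
`2^K`-descent lifting line is not certified, e.g. the `K = 4` doors). [cite: Miller2011LMS, Def. 1.1 (arXiv:1010.2431 p. 3)] -/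
theorem missingUpperBoundAt_two_of_exponent (hfin : W.ShaFinite) {K : ℕ}
    (h2 : Nat.card (AddSubgroup.torsionBy W.sha 2) = 4)
    (hexp : ∀ (x : W.sha) (n : ℕ), 2 ^ n • x = 0 → 2 ^ K • x = 0)
    {q : ℚ} (hq : shaAn W = (q : ℂ)) (hv : ((2 * K : ℕ) : ℤ) ≤ padicValRat 2 q) :
    MissingUpperBoundAt W 2 := by
  haveI : Finite W.sha := hfin
  haveI : Fact (Nat.Prime 2) := ⟨Nat.prime_two⟩
  have hstab : ∀ x : W.sha, 2 ^ (K + 1) • x = 0 → 2 ^ K • x = 0 := fun x hx => hexp x (K + 1) hx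
  have hcard : Nat.card (AddSubgroup.torsionBy W.sha (2 ^ K : ℕ)) = 2 ^ padicValNat 2 (Nat.card W.sha) :=
    card_torsionBy_eq_pow_padicValNat_of_stable hstab
  have hle : 2 ^ padicValNat 2 (Nat.card W.sha) ≤ 2 ^ (2 * K) := by
    rw [← hcard, pow_mul]
    calc Nat.card (AddSubgroup.torsionBy W.sha (2 ^ K : ℕ))
        ≤ Nat.card (AddSubgroup.torsionBy W.sha 2) ^ K := card_torsionBy_two_pow_le_pow K
      _ = (2 ^ 2) ^ K := by rw [h2]; norm_num
  have hv' : padicValNat 2 (Nat.card W.sha) ≤ 2 * K := (Nat.pow_le_pow_iff_right (by norm_num)).1 hle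
  refine ⟨q, hq, le_trans ?_ hv⟩
  rw [WeierstrassCurve.shaOrder]
  exact_mod_cast hv'

variable {N : ℕ} [NeZero N] {K : Type u} [Field K] [NumberField K]

/-- **THE DOOR, UPPER HALF, on every class it applies to** (no lifting record): B₂ + (H1) + (H2) +
`2^(K+1) ∤ [E(K):ℤP]` + `#Ш[2] = 4` + `2K ≤ ord₂ #Ш_an` ⟹ `ord₂ #Ш(E/ℚ) ≤ ord₂ #Ш(E/ℚ)_an`
(`MissingUpperBoundAt W 2`; `Ш` finite at `r_an = 0` by GZK, `hfin`).
[cite: Kolyvagin1989Izv, Thm. B_l (l = 2), p. 475–476] [cite: Miller2011LMS, Def. 1.1] -/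
theorem missingUpperBoundAt_two_of_kolyvaginB_two [W.IsElliptic] (hfin : W.ShaFinite)
    (hB2 : Kolyvagin1989_theoremB_two N W K)
    (hK : IsImaginaryQuadratic K) (hH : SatisfiesHeegnerHypothesis N K)
    (h3 : NumberField.discr K ≠ -3) (h4 : NumberField.discr K ≠ -4) (h8 : NumberField.discr K ≠ -8)
    (hΔ₁ : ¬ IsSquare ((NumberField.discr K : ℚ) * -|W.Δ|))
    (hΔ₂ : ¬ IsSquare ((NumberField.discr K : ℚ) * (-(2 * |W.Δ|))))
    {P : (W.baseChange K).toAffine.Point} (hP : IsHeegnerPoint N W K P) (hnt : ¬ IsOfFinAddOrder P)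
    (hr0 : W.analyticRank = 0) (hρ : O1.TwoAdicSurjective W)
    {L : ℕ} (hI : ¬ 2 ^ (L + 1) ∣ (AddSubgroup.zmultiples P).index)
    (h2 : Nat.card (AddSubgroup.torsionBy W.sha 2) = 4)
    {q : ℚ} (hq : shaAn W = (q : ℂ)) (hv : ((2 * L : ℕ) : ℤ) ≤ padicValRat 2 q) :
    MissingUpperBoundAt W 2 :=
  missingUpperBoundAt_two_of_exponent W hfin h2
    (sha_two_pow_smul_eq_zero_of_kolyvaginB_two W hB2 hK hH h3 h4 hP hnt hr0 hρ h8 hΔ₁ hΔ₂ hI) hq hv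

end Upper

end Summit.BirchSwinnertonDyer.Rank1Residual.X5.HeegnerIndexDoor

end
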